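import Summits.QuantumAdvantage.QuantumAdvantage.Theorems.WalkThreeStepFarReadDown

/-!
# Rung (G♯₂) `ThreeStepFreeRungFive` (item stmt-QuantumAdvantage-23286), architecture (U), the FAR-READ LEMMA 5c/6: line values of
# window and block witnesses (for the freedom lemma)

Cell qa-qnc0, route OddPrimeWalk, support item stmt-QuantumAdvantage-23286; prover qn-prover-3 g17.

In a `Scene` the far cut `hq` is non-constant and reads `π` with coefficient `a ≠ 0`.  We construct an indicator input `x* = indic P`
with `10` at `π` and at `h` on which the `π`-difference of `hq` is `δ(x*) = 1`, of the shape `P = {π−1, h−1} ∪ [β, β+j)` with the block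
placed in one of three "freedom regions" (below everything, between, above everything — each with two candidate positions so that the
other read `ρ_h` straddles none), or — in the RIGID case `γ = 0`, `b = −a`, `ρ_h` close to `π`, where every block coefficient vanishes
and the fire bit is a short window count — in the window next to `π`, using the non-constancy of `hq` to know the offset `r` is in range.
THIS FILE: counting helpers, the line value `lv` of the far cut at an indicator input, the block computation `lv_wit`, the generic
block witness `exists_wit_of_block`, and the rigid-case ingredients (`fire_window_lo/hi`, `lv_lo`, `lv_hi`).  The witness itself
(`Scene.exists_witness`) is assembled in `WalkThreeStepFarReadWitness`.
WHAT THIS IS NOT: the contradiction itself is file 6/6; separation NOT moved.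
-/

namespace Summit.QuantumAdvantage.AdviceFreeQNC0.LocalEngine

open Finset Classical

namespace RungU

variable {n : ℕ}

/-! ### §1 Counting helpers -/

/-- below-`r` count of a two-element set. -/
theorem card_lt_pair (a b r : ℕ) (hab : a ≠ b) :
    (({a, b} : Finset ℕ).filter fun j => j < r).card = (if a < r then 1 else 0) + (if b < r then 1 else 0) := by
  by_cases ha : a < r <;> by_cases hb : b < r <;> simp [Finset.filter_insert, Finset.filter_singleton, ha, hb, hab]

/-- adding a disjoint five-block that does not straddle `r` raises the below-`r` count by `j` or by `0`. -/
theorem card_lt_union_block (P₀ : Finset ℕ) (β j r : ℕ) (hj : j ≤ 5) (hdis : ∀ i ∈ P₀, ¬ (β ≤ i ∧ i < β + j))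
    (hr : β + 5 ≤ r ∨ r ≤ β) :
    ((P₀ ∪ Ico β (β + j)).filter fun i => i < r).card = (P₀.filter fun i => i < r).card + (if β + 5 ≤ r then j else 0) := by
  rw [card_lt_union _ _ (Finset.disjoint_left.mpr fun i hi hI => hdis i hi (Finset.mem_Ico.mp hI)), card_lt_Ico]
  rcases hr with h | h
  · rw [if_pos h, block_below β j r (by omega)]
  · rw [block_above β j r h]
    by_cases h' : β + 5 ≤ r
    · have : j = 0 := by omega
      rw [if_pos h', this]
    · rw [if_neg h']

/-- the cardinality after adding a disjoint block. -/
theorem card_union_block (P₀ : Finset ℕ) (β j : ℕ) (hdis : ∀ i ∈ P₀, ¬ (β ≤ i ∧ i < β + j)) :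
    (P₀ ∪ Ico β (β + j)).card = P₀.card + j := by
  rw [Finset.card_union_of_disjoint (Finset.disjoint_left.mpr fun i hi hI => hdis i hi (Finset.mem_Ico.mp hI)), Nat.card_Ico]
  omega

/-- the number of ones in a band is at most its length. -/
theorem card_band_le (u : Fin n → Bool) (lo hi : ℕ) :
    (univ.filter fun i : Fin n => lo ≤ i.val ∧ i.val < hi ∧ u i = true).card ≤ hi - lo := by
  have h : ((univ.filter fun i : Fin n => lo ≤ i.val ∧ i.val < hi ∧ u i = true).image Fin.val) ⊆ Finset.Ico lo hi := by
    intro j hj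
    rw [Finset.mem_image] at hj
    obtain ⟨i, hi, rfl⟩ := hj
    rw [Finset.mem_filter] at hi
    rw [Finset.mem_Ico]
    exact ⟨hi.2.1, hi.2.2.1⟩
  have := Finset.card_le_card h
  rw [Finset.card_image_of_injective _ Fin.val_injective, Nat.card_Ico] at this
  exact this

/-- a non-constant cut fires somewhere. -/
theorem exists_fire {p : ℕ} (S : ThreeStep p n) (q : Fin (n + 1)) (h : ¬ IsConst S q) : ∃ u : Fin n → Bool, S.y q u = true := by
  by_contra hne
  push Not at hne
  apply h
  intro u v
  have hu : S.y q u = false := by simpa using hne u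
  have hv : S.y q v = false := by simpa using hne v
  rw [hu, hv]

namespace Scene

variable (sc : Scene n)

/-! ### §2 The line value at indicator inputs -/

/-- the line value `a·N(π) + b·N(ρ_h) + γ·W` of the far cut at the indicator input of `P`. -/
def lv (P : Finset ℕ) : ZMod 5 :=
  cf sc.S sc.hq sc.π * (((P.filter fun j => j < sc.π).card : ℕ) : ZMod 5)
    + otherCoef sc.S sc.hq sc.π * (((P.filter fun j => j < sc.ρh).card : ℕ) : ZMod 5) + sc.S.γ sc.hq * ((P.card : ℕ) : ZMod 5)

/-- `δ = 1` at an indicator input whose line value hits `r` or `r + a`. -/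
theorem dlt_true_of_lv (P : Finset ℕ) (hP : ∀ j ∈ P, j < n) (h1 : sc.π - 1 ∈ P) (h0 : sc.π ∉ P)
    (h : sc.lv P = sc.S.r sc.hq ∨ sc.lv P = sc.S.r sc.hq + cf sc.S sc.hq sc.π) :
    dlt sc.S sc.π (indic P : Fin n → Bool) sc.hq = true := by
  have hr := sc.room
  rw [dlt_eq_dfun sc.S sc.hq sc.reads (by omega) (by omega) (ten_indic P (by omega) h1 h0), wtPrefix_indic P hP,
    wtPrefix_indic P hP, wt_indic P hP]
  unfold lv at h
  rcases h with e | e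
  · exact dfun_true_of_hit _ _ _ _ _ _ _ e sc.reads
  · exact dfun_true_of_hit' _ _ _ _ _ _ _ e sc.reads

/-- the witness shape: base `{π−1, h−1}` plus a block. -/
def wit (β j : ℕ) : Finset ℕ := ({sc.π - 1, sc.h - 1} : Finset ℕ) ∪ Ico β (β + j)

/-- membership in the witness shape. -/
theorem mem_wit {β j i : ℕ} : i ∈ sc.wit β j ↔ (i = sc.π - 1 ∨ i = sc.h - 1 ∨ (β ≤ i ∧ i < β + j)) := by
  unfold wit
  simp only [Finset.mem_union, Finset.mem_insert, Finset.mem_singleton, Finset.mem_Ico, or_assoc]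

/-- the base is disjoint from a block avoiding `π − 1` and `h − 1`. -/
theorem base_disjoint {β j : ℕ} (h1 : ¬ (β ≤ sc.π - 1 ∧ sc.π - 1 < β + j)) (h2 : ¬ (β ≤ sc.h - 1 ∧ sc.h - 1 < β + j)) :
    ∀ i ∈ ({sc.π - 1, sc.h - 1} : Finset ℕ), ¬ (β ≤ i ∧ i < β + j) := by
  intro i hi
  simp only [Finset.mem_insert, Finset.mem_singleton] at hi
  rcases hi with rfl | rfl
  · exact h1
  · exact h2

/-- **block computation**: for a block that straddles none of `π, ρ_h` and avoids the base, the line value of the witness shape is the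
base value plus `j κ`, `κ = a[block<π] + b[block<ρ_h] + γ`. -/
theorem lv_wit (β j : ℕ) (hj : j ≤ 5) (hβπ : β + 5 ≤ sc.π - 1 ∨ sc.π + 1 ≤ β)
    (hβh : β + 5 ≤ sc.h - 1 ∨ sc.h + 1 ≤ β) (hβρ : β + 5 ≤ sc.ρh ∨ sc.ρh ≤ β) :
    sc.lv (sc.wit β j) = sc.lv (sc.wit β 0)
      + (cf sc.S sc.hq sc.π * (if β + 5 ≤ sc.π then 1 else 0) + otherCoef sc.S sc.hq sc.π * (if β + 5 ≤ sc.ρh then 1 else 0)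
        + sc.S.γ sc.hq) * (j : ℕ) := by
  have hdis := sc.base_disjoint (β := β) (j := j) (by omega) (by omega)
  have hdis0 := sc.base_disjoint (β := β) (j := 0) (by omega) (by omega)
  unfold lv wit
  rw [card_lt_union_block _ β j sc.π hj hdis (by omega), card_lt_union_block _ β j sc.ρh hj hdis hβρ, card_union_block _ β j hdis,
    card_lt_union_block _ β 0 sc.π (by omega) hdis0 (by omega), card_lt_union_block _ β 0 sc.ρh (by omega) hdis0 hβρ,
    card_union_block _ β 0 hdis0]
  by_cases h1 : β + 5 ≤ sc.π <;> by_cases h2 : β + 5 ≤ sc.ρh <;> simp only [h1, h2, if_true, if_false] <;> push_cast <;> ring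

/-- **generic witness**: a non-straddling admissible block with non-zero coefficient gives `δ = 1` for some `j < 5`. -/
theorem exists_wit_of_block (β : ℕ) (hβn : β + 5 ≤ n) (hβπ : β + 5 ≤ sc.π - 1 ∨ sc.π + 1 ≤ β)
    (hβh : β + 5 ≤ sc.h - 1 ∨ sc.h + 1 ≤ β) (hβρ : β + 5 ≤ sc.ρh ∨ sc.ρh ≤ β)
    (hκ : cf sc.S sc.hq sc.π * (if β + 5 ≤ sc.π then 1 else 0) + otherCoef sc.S sc.hq sc.π * (if β + 5 ≤ sc.ρh then 1 else 0)
      + sc.S.γ sc.hq ≠ 0) :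
    ∃ j : ℕ, j < 5 ∧ dlt sc.S sc.π (indic (sc.wit β j) : Fin n → Bool) sc.hq = true := by
  have hr := sc.room
  have hh := sc.h_bounds
  have hfar := sc.far
  obtain ⟨j, hj, e⟩ := exists_step_hit _ (sc.lv (sc.wit β 0)) (sc.S.r sc.hq) hκ
  refine ⟨j, hj, ?_⟩
  have hP : ∀ i ∈ sc.wit β j, i < n := fun i hi => by rw [mem_wit] at hi; omega
  apply sc.dlt_true_of_lv _ hP (sc.mem_wit.mpr (Or.inl rfl)) (fun hm => by rw [mem_wit] at hm; omega)
  left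
  rw [sc.lv_wit β j (by omega) hβπ hβh hβρ]
  exact e

/-! ### §3 The rigid case -/

/-- in the rigid case (`γ = 0`, `b = −a`) the fire bit of `hq` is a window count: `ρ_h ≤ π` version. -/
theorem fire_window_lo (hγ : sc.S.γ sc.hq = 0) (hb : otherCoef sc.S sc.hq sc.π = -cf sc.S sc.hq sc.π) (hρ : sc.ρh ≤ sc.π)
    {u : Fin n → Bool} (hu : sc.S.y sc.hq u = true) :
    ∃ c : ℕ, c ≤ sc.π - sc.ρh ∧ cf sc.S sc.hq sc.π * (c : ℕ) = sc.S.r sc.hq := by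
  refine ⟨(univ.filter fun i : Fin n => sc.ρh ≤ i.val ∧ i.val < sc.π ∧ u i = true).card, card_band_le u _ _, ?_⟩
  rw [y_eq_cf sc.S sc.hq sc.π sc.reads u, hγ, hb, decide_eq_true_eq] at hu
  have e := card_band_eq u hρ
  unfold ρh at e ⊢
  rw [← hu, ← e]
  push_cast
  ring

/-- … `π ≤ ρ_h` version. -/
theorem fire_window_hi (hγ : sc.S.γ sc.hq = 0) (hb : otherCoef sc.S sc.hq sc.π = -cf sc.S sc.hq sc.π) (hρ : sc.π ≤ sc.ρh)
    {u : Fin n → Bool} (hu : sc.S.y sc.hq u = true) :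
    ∃ c : ℕ, c ≤ sc.ρh - sc.π ∧ -(cf sc.S sc.hq sc.π * (c : ℕ)) = sc.S.r sc.hq := by
  refine ⟨(univ.filter fun i : Fin n => sc.π ≤ i.val ∧ i.val < sc.ρh ∧ u i = true).card, card_band_le u _ _, ?_⟩
  rw [y_eq_cf sc.S sc.hq sc.π sc.reads u, hγ, hb, decide_eq_true_eq] at hu
  have e := card_band_eq u hρ
  unfold ρh at e ⊢
  rw [← hu, ← e]
  push_cast
  ring

/-- line value of a lower window witness `{π−1, h−1} ∪ [π−1−v, π−1)` when `ρ_h ≤ π − 1 − v`: `a (1 + v)`. -/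
theorem lv_lo (hγ : sc.S.γ sc.hq = 0) (hb : otherCoef sc.S sc.hq sc.π = -cf sc.S sc.hq sc.π) (v : ℕ) (hv : v ≤ 4)
    (hρ : sc.ρh ≤ sc.π - 1 - v) (hiff : sc.h - 1 < sc.ρh ↔ sc.h - 1 < sc.π) :
    sc.lv (sc.wit (sc.π - 1 - v) v) = cf sc.S sc.hq sc.π + cf sc.S sc.hq sc.π * (v : ℕ) := by
  have hr := sc.room
  have hh := sc.h_bounds
  have hfar := sc.far
  have hdj : Disjoint ({sc.π - 1, sc.h - 1} : Finset ℕ) (Ico (sc.π - 1 - v) (sc.π - 1 - v + v)) :=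
    Finset.disjoint_left.mpr fun i hi hI => by
      simp only [Finset.mem_insert, Finset.mem_singleton] at hi; rw [Finset.mem_Ico] at hI; omega
  have c1 : ((sc.wit (sc.π - 1 - v) v).filter fun i => i < sc.π).card = 1 + (if sc.h - 1 < sc.π then 1 else 0) + v := by
    unfold wit
    rw [card_lt_union _ _ hdj, card_lt_pair _ _ _ (by omega), card_lt_Ico, if_pos (by omega), block_below _ v _ (by omega)]
  have c2 : ((sc.wit (sc.π - 1 - v) v).filter fun i => i < sc.ρh).card = (if sc.h - 1 < sc.π then 1 else 0) := by
    unfold wit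
    rw [card_lt_union _ _ hdj, card_lt_pair _ _ _ (by omega), card_lt_Ico, if_neg (by omega), block_above _ v _ hρ]
    by_cases hd : sc.h - 1 < sc.π
    · rw [if_pos hd, if_pos (hiff.mpr hd)]
    · rw [if_neg hd, if_neg (fun h' => hd (hiff.mp h'))]
  unfold lv
  rw [c1, c2, hγ, hb]
  by_cases hd : sc.h - 1 < sc.π
  · rw [if_pos hd]; push_cast; ring
  · rw [if_neg hd]; push_cast; ring

/-- line value of an upper window witness `{π−1, h−1} ∪ [π+1, π+1+v)` when `π + 1 + v ≤ ρ_h`: `−a v`. -/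
theorem lv_hi (hγ : sc.S.γ sc.hq = 0) (hb : otherCoef sc.S sc.hq sc.π = -cf sc.S sc.hq sc.π) (v : ℕ) (hv : v ≤ 4)
    (hρ : sc.π + 1 + v ≤ sc.ρh) (hiff : sc.h - 1 < sc.ρh ↔ sc.h - 1 < sc.π) :
    sc.lv (sc.wit (sc.π + 1) v) = -(cf sc.S sc.hq sc.π * (v : ℕ)) := by
  have hr := sc.room
  have hh := sc.h_bounds
  have hfar := sc.far
  have hdj : Disjoint ({sc.π - 1, sc.h - 1} : Finset ℕ) (Ico (sc.π + 1) (sc.π + 1 + v)) :=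
    Finset.disjoint_left.mpr fun i hi hI => by
      simp only [Finset.mem_insert, Finset.mem_singleton] at hi; rw [Finset.mem_Ico] at hI; omega
  have c1 : ((sc.wit (sc.π + 1) v).filter fun i => i < sc.π).card = 1 + (if sc.h - 1 < sc.π then 1 else 0) := by
    unfold wit
    rw [card_lt_union _ _ hdj, card_lt_pair _ _ _ (by omega), card_lt_Ico, if_pos (by omega), block_above _ v _ (by omega),
      add_zero]
  have c2 : ((sc.wit (sc.π + 1) v).filter fun i => i < sc.ρh).card = 1 + (if sc.h - 1 < sc.π then 1 else 0) + v := by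
    unfold wit
    rw [card_lt_union _ _ hdj, card_lt_pair _ _ _ (by omega), card_lt_Ico, if_pos (by omega), block_below _ v _ hρ]
    by_cases hd : sc.h - 1 < sc.π
    · rw [if_pos hd, if_pos (hiff.mpr hd)]
    · rw [if_neg hd, if_neg (fun h' => hd (hiff.mp h'))]
  unfold lv
  rw [c1, c2, hγ, hb]
  by_cases hd : sc.h - 1 < sc.π
  · rw [if_pos hd]; push_cast; ring
  · rw [if_neg hd]; push_cast; ring

end Scene

end RungU

end Summit.QuantumAdvantage.AdviceFreeQNC0.LocalEngine
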